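/-
Copyright (c) 2026. All rights reserved.
Released under Apache 2.0 license as described in the file LICENSE.
Authors: abc-iut cell, seat abc-iut-f-072 (F fact-proving wave, tranche 72: FACT-LIST rows F-0318
`TotallyBoxRigidStmt`, F-0314 `Cor_3_7_v`).
-/
import Literature.AnabelianGeometry.AbsoluteAnabelian.AbsTopIII.BiAnabelianModelSlim
import Literature.AnabelianGeometry.AbsoluteAnabelian.AbsTopIII.BiAnabelianModelNonRigidity
import HarnessLib

/-!
# [AbsTopIII] Corollary 3.7 (v), total `□`-rigidity: the exact criterion, the printed instance
# UNCONDITIONALLY (no lift datum `θ^bi`), and the failure of the universal closure at the bare model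

S. Mochizuki, *Topics in absolute anabelian geometry III* [MochizukiAbsTopIII2015] (kurims manuscript
`paper:url-5493eb38cbb7`), Cor 3.7 (v) p. 88: "The vertex `□` of the second row of `𝒟*` is a nexus of
`Γ⃗_{𝒟*}`.  Moreover, `𝒟*` is totally `□`-rigid, and the natural action of `ℤ` on the infinite linear
oriented graph `Γ⃗_{𝒟†_{≤1}}` extends to an action of `ℤ` on `𝒟*` by nexus-classes of self-equivalences of
`𝒟*`. [...]" (print's third sentence, "Finally, the self-equivalences in these nexus-classes are
compatible with `H_δ` [cf. (ii)], as well as [...]", is outside the scope of the typed `Cor_3_7_v`).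
Proof p. 88: "The proofs of the various assertions of the present Corollary 3.7 are entirely similar to
the proofs of the corresponding assertions of Corollary 3.6."
— i.e. (proof of Cor 3.6 (v), p. 82) "The total `□`-rigidity in question follows immediately from
Proposition 3.2, (iv) [...]"; Prop 3.2 (iv) p. 72: "In particular, if `(Π ↷ M_T)` is of hyperbolic orbicurve type,
then the group `Aut_{𝒞^MLF_T}((Π ↷ M_T))` — which is isomorphic to a subgroup of `Aut_{𝒯𝔾}(Π)` that
contains the subgroup of `Aut_{𝒯𝔾}(Π)` determined by the inner automorphisms of `Π` — is center-free;
the categories [...] `𝒞^{MLF-sB}_T` [...] are id-rigid [cf. §0]."  (v2, doc-only: this quotation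
re-sourced verbatim — v1 dropped "— is center-free;" and misplaced "In particular," — per referee
defect L13-n3; declarations unchanged.)

PROOF-ONLY companion (FACT-LIST rows F-0318 `BiAnabelianSetting.TotallyBoxRigidStmt` and F-0314
`BiAnabelianSetting.Cor_3_7_v` of abc-iut-L4-t9's `BiAnabelianDiagrams.lean`; both are SCHEMATA over
an abstract `𝔖 : BiAnabelianSetting X E N`, so per plan R5 the deliverable is: the universal closure
decided, and the instance forms at the named instances proved).  Contents:

* `BiAnabelianSetting.isIdRigid_sq_of_rigid` — `𝒳 ×_𝔈 𝒳` is id-rigid as soon as the two projections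
  `pr_⋎`, `π_⋎` are rigid (a morphism of the categorical fibre product is the pair of its components);
* `BiAnabelianSetting.totallyBoxRigidStmt_iff` — **the exact criterion**: `𝒟*` is totally `□`-rigid
  iff `𝒳` is id-rigid and `pr_⋎`, `π_⋎` are rigid (the converse of abc-iut-L4-t12's
  `totallyBoxRigidStmt_of`: the pre-nexus portion contains the vertex `□` (category `𝒳`) and the edges
  `pr_⋎ : ⋎ → □`, `π_⋎ : ⋎ → ref`); `cor_3_7_v_iff_rigid` — the same for `Cor_3_7_v` (nexus clause and
  `ℤ`-action are unconditional: `Cor37Vertex.box_isNexus`, `BiAnabelianSetting.shiftStmt`);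
* AT THE MODEL (abc-iut-L4-t9's `TFModel.modelSetting p`, restricted — `BiAnabelianSetting.restrict` —
  to ANY object property `P` whose objects have slim `Π_k`; print: `P` = "of strictly Belyi type",
  slim by [AbsTopI] Prop 2.3 (ii)): `TFModel.isRigidFunctor_pr_restrict`,
  `TFModel.isRigidFunctor_proj_restrict` — **`pr_⋎` and `π_⋎` are rigid, by the printed mechanism of
  Prop 3.2 (iv)**: an automorphism of `pr_⋎` has at `(A₁, A₂, α)` a component commuting with every inner
  automorphism `(conj_g, ε(g))` of `A₁` (these lift to `𝒳 ×_𝔈 𝒳` as `(conj_g, conj_{α g})`,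
  `exists_innerAut_sq`), hence is the
  identity by `TFModel.Hom.eq_id_of_comm_innerAut` (slimness of `Π_k` and of `G_{ℚ_p}`).  Consequently
  `TFModel.totallyBoxRigidStmt_holds P hP`, `TFModel.cor_3_7_v_holds P hP` — **Cor 3.7 (v) as typed holds
  for every such `P`-sub-model UNCONDITIONALLY**, in particular for the slim sub-model
  `TFModel.modelSettingSlim p` (`totallyBoxRigidStmt_modelSettingSlim`, `cor_3_7_v_modelSettingSlim`).
  This removes the lift datum `θ^bi` from abc-iut-L4-t9's `model_slim_cor_3_7_v θ` /
  `model_of_cor_3_7_of_full` as far as (v) is concerned (that `θ`-type is EMPTY at the slim sub-model,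
  `BiAnabelianModelLiftVacuity.lean`, so the earlier statements of (v) there were vacuous);
* `TFModel.not_totallyBoxRigidStmt_modelSetting`, `TFModel.not_cor_3_7_v_modelSetting`,
  `BiAnabelianSetting.not_forall_totallyBoxRigidStmt`, `not_forall_cor_3_7_v` — **the universal closures
  of both rows are FALSE**: at the bare model (all `Π_k ↠ G_k`, no `sB` restriction) `𝒳 = TFModel p` is
  not id-rigid (abc-iut-L4-t9's `TFModel.not_isIdRigid`, the sign twist `η`), so `𝒟*` is not totally
  `□`-rigid there.  R5: the rows are facts AT NAMED INSTANCES ONLY — the `sB`-type restriction is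
  load-bearing, exactly as print states (v) for `𝒳 = 𝒞^{MLF-sB}_{T𝔽}`.

HONEST FRAMING: refereed pre-IUT anabelian geometry ([AbsTopIII] §3); statements about the tree's typed
Cor 3.7 (v) and abc-iut-L4-t9's model of Def 3.1 on `ℚ̄_p`; nothing here bears on [IUTchIII] Cor. 3.12
(no side taken); typed ≠ proved except for the theorems of this file.
-/

set_option autoImplicit false

namespace Literature.AnabelianGeometry.AbsoluteAnabelian.AbsTopIII

open CategoryTheory CategoryTheory.Limits DiagramOfCategories
open Literature.AlgebraicGeometry.Frobenioids (IsSlimGroup)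

universe u

/-! ## The exact criterion for total `□`-rigidity of `𝒟*` (abstract setting) -/

namespace BiAnabelianSetting

variable {X E N : Type u} [Category.{u} X] [Category.{u} E] [Category.{u} N]
  (𝔖 : BiAnabelianSetting X E N)

/-- **`𝒳 ×_𝔈 𝒳` is id-rigid as soon as `pr_⋎` and `π_⋎` are rigid**: an automorphism `α` of the
identity functor of `𝒳 ×_𝔈 𝒳`, whiskered with the two projections, gives automorphisms of `pr_⋎` and
`π_⋎`, whose components are the two components of `α`; a morphism of the categorical fibre product is
determined by its components. [cite: MochizukiAbsTopIII2015, Cor 3.7 (v) p.88] -/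
theorem isIdRigid_sq_of_rigid (hpr : IsRigidFunctor 𝔖.pr) (hproj : IsRigidFunctor 𝔖.proj) :
    IsIdRigid 𝔖.Sq := by
  refine isRigidFunctor_of_hom_app_eq_id fun α o => ?_
  have h1 := hpr.hom_app_eq_id (Functor.isoWhiskerRight α 𝔖.pr) o
  have h2 := hproj.hom_app_eq_id (Functor.isoWhiskerRight α 𝔖.proj) o
  rw [Functor.isoWhiskerRight_hom, Functor.whiskerRight_app] at h1 h2
  apply CategoricalPullback.hom_ext
  · exact h1
  · exact h2

/-- `□` lies in the pre-nexus portion `Γ⃗_{𝒟*≤□}`. [cite: MochizukiAbsTopIII2015, Cor 3.7 (v) p.88] -/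
theorem box_mem_preBox :
    Cor37Vertex.box ∈ ({a : Cor37Vertex | a.BelowBox} ∪ {Cor37Vertex.box} : Set Cor37Vertex) :=
  (Cor37Vertex.mem_preBox_iff _).2 (by simp [Cor37Vertex.row])

/-- A first-row vertex lies in the pre-nexus portion `Γ⃗_{𝒟*≤□}`.
[cite: MochizukiAbsTopIII2015, Cor 3.7 (v) p.88] -/
theorem first_mem_preBox (n : ℤ) :
    Cor37Vertex.first n ∈ ({a : Cor37Vertex | a.BelowBox} ∪ {Cor37Vertex.box} : Set Cor37Vertex) :=
  (Cor37Vertex.mem_preBox_iff _).2 (by simp [Cor37Vertex.row])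

/-- The core vertex lies in the pre-nexus portion `Γ⃗_{𝒟*≤□}`.
[cite: MochizukiAbsTopIII2015, Cor 3.7 (v) p.88] -/
theorem ref_mem_preBox :
    Cor37Vertex.ref ∈ ({a : Cor37Vertex | a.BelowBox} ∪ {Cor37Vertex.box} : Set Cor37Vertex) :=
  (Cor37Vertex.mem_preBox_iff _).2 (by simp [Cor37Vertex.row])

/-- **Cor 3.7 (v), total `□`-rigidity — the exact criterion.**  `𝒟*` is totally `□`-rigid (Def 3.5
(vi): the pre-nexus portion `𝒟*_{≤□}` — row 1, the core vertex, `□`, with edges `log_𝒳, pr_⋎, π_⋎, δ_⋎,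
δ_□` — is vertex-rigid and edge-rigid) **iff** `𝒳` is id-rigid and the projections `pr_⋎`, `π_⋎` are
rigid.  (⇒: `□` carries `𝒳`, and `pr_⋎`, `π_⋎` are edges of `𝒟*_{≤□}`.  ⇐: `𝒳 ×_𝔈 𝒳` is then id-rigid
(`isIdRigid_sq_of_rigid`), hence `log_𝒳 ≅ 𝟭` is rigid; `δ_⋎` is rigid from `𝒳`; `δ_□ = 𝟭_𝒳`; assemble
with abc-iut-L4-t12's `totallyBoxRigidStmt_of`.)  In print the right-hand side is what "follows
immediately from Proposition 3.2, (iv)". [cite: MochizukiAbsTopIII2015, Cor 3.7 (v) p.88] -/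
theorem totallyBoxRigidStmt_iff :
    𝔖.TotallyBoxRigidStmt ↔ IsIdRigid X ∧ IsRigidFunctor 𝔖.pr ∧ IsRigidFunctor 𝔖.proj := by
  constructor
  · rintro ⟨_, hV, hE⟩
    refine ⟨hV ⟨Cor37Vertex.box, box_mem_preBox⟩, ?_, ?_⟩
    · exact hE (a := ⟨Cor37Vertex.first 0, first_mem_preBox 0⟩) (b := ⟨Cor37Vertex.box, box_mem_preBox⟩)
        (Cor37Edge.pr 0)
    · exact hE (a := ⟨Cor37Vertex.first 0, first_mem_preBox 0⟩) (b := ⟨Cor37Vertex.ref, ref_mem_preBox⟩)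
        (Cor37Edge.proj 0)
  · rintro ⟨hX, hpr, hproj⟩
    have hSq := 𝔖.isIdRigid_sq_of_rigid hpr hproj
    exact 𝔖.totallyBoxRigidStmt_of hSq hX (𝔖.isRigidFunctor_logSq hSq) hpr hproj
      (𝔖.isRigidFunctor_diag hX)

/-- In particular total `□`-rigidity of `𝒟*` forces the id-rigidity of `𝒳` (the vertex `□`).
[cite: MochizukiAbsTopIII2015, Cor 3.7 (v) p.88] -/
theorem isIdRigid_of_totallyBoxRigidStmt (h : 𝔖.TotallyBoxRigidStmt) : IsIdRigid X :=
  (𝔖.totallyBoxRigidStmt_iff.1 h).1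

/-- **Cor 3.7 (v) as typed (`Cor_3_7_v` = nexus ∧ total `□`-rigidity ∧ `ℤ`-action) — the exact
criterion**: since the nexus clause (`Cor37Vertex.box_isNexus`) and the `ℤ`-action
(`BiAnabelianSetting.shiftStmt`) hold for every setting, `Cor_3_7_v` holds iff `𝒳` is id-rigid and
`pr_⋎`, `π_⋎` are rigid. [cite: MochizukiAbsTopIII2015, Cor 3.7 (v) p.88] -/
theorem cor_3_7_v_iff_rigid :
    𝔖.Cor_3_7_v ↔ IsIdRigid X ∧ IsRigidFunctor 𝔖.pr ∧ IsRigidFunctor 𝔖.proj := by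
  rw [𝔖.cor_3_7_v_iff, ← 𝔖.totallyBoxRigidStmt_iff]
  exact ⟨fun h => h.1, fun h => ⟨h, 𝔖.shiftStmt⟩⟩

/-- `Cor_3_7_v` is equivalent to its total-`□`-rigidity conjunct alone.
[cite: MochizukiAbsTopIII2015, Cor 3.7 (v) p.88] -/
theorem cor_3_7_v_iff_totallyBoxRigidStmt : 𝔖.Cor_3_7_v ↔ 𝔖.TotallyBoxRigidStmt := by
  rw [𝔖.cor_3_7_v_iff_rigid, 𝔖.totallyBoxRigidStmt_iff]

end BiAnabelianSetting

/-! ## The printed instance: `P`-sub-models of the model with slim `Π_k` — rigidity of `pr_⋎`, `π_⋎`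
from the inner automorphisms (Prop 3.2 (iv)), no lift datum needed -/

namespace TFModel

variable (p : ℕ) [hp : Fact p.Prime] (P : ObjectProperty (TFModel p))

/-- **Inner automorphisms lift to `𝒳 ×_𝔈 𝒳`**: for an object `(A₁, A₂, α)` of the fibre product over
the `P`-sub-model and `g ∈ Π_{A₁}`, the pair `((conj_g, ε(g)), (conj_{α g}, ε(α g)))` is an endomorphism
of `(A₁, A₂, α)` (compatibility with the structure isomorphism: `α(g h g⁻¹) = α(g) α(h) α(g)⁻¹`).
[cite: MochizukiAbsTopIII2015, Proposition 3.2 (iv) p.72] -/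
theorem exists_innerAut_sq (o : ((modelSetting p).restrict P fun _ h => h).Sq) (g : o.fst.obj.pair.Pi) :
    ∃ m : o ⟶ o, m.fst = ObjectProperty.homMk (o.fst.obj.innerAut g) ∧
      m.snd = ObjectProperty.homMk (o.snd.obj.innerAut ((o.iso.hom : TopGroupObj.Hom _ _).iso g)) :=
  ⟨{ fst := ObjectProperty.homMk (o.fst.obj.innerAut g)
     snd := ObjectProperty.homMk (o.snd.obj.innerAut ((o.iso.hom : TopGroupObj.Hom _ _).iso g))
     w := by
      refine TopGroupObj.Hom.ext fun (x : o.fst.obj.pair.Pi) => ?_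
      -- `α` as a homomorphism between the Galois groups of the two pairs (same types on the nose)
      let α : o.fst.obj.pair.Pi →* o.snd.obj.pair.Pi :=
        ((o.iso.hom : TopGroupObj.Hom _ _).iso).toMonoidHom
      show α (g * x * g⁻¹) = α g * α x * (α g)⁻¹
      rw [map_mul, map_mul, map_inv] }, rfl, rfl⟩

variable (hP : ∀ A : TFModel p, P A → IsSlimGroup A.pair.Pi)

include hP in
/-- **`pr_⋎ : 𝒳 ×_𝔈 𝒳 → 𝒳` is rigid on every `P`-sub-model with slim `Π_k`** (no lift datum `θ^bi`):
the component of an automorphism of `pr_⋎` at `(A₁, A₂, α)` commutes — by naturality along the lifted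
inner automorphisms (`exists_innerAut_sq`) — with every inner automorphism of `A₁`, hence is the identity
by the printed deduction of Prop 3.2 (iv) (`TFModel.Hom.eq_id_of_comm_innerAut`: slimness of `Π_k` and
of `G_{ℚ_p}`). [cite: MochizukiAbsTopIII2015, Cor 3.7 (v) p.88] -/
theorem isRigidFunctor_pr_restrict : IsRigidFunctor ((modelSetting p).restrict P fun _ h => h).pr := by
  refine isRigidFunctor_of_hom_app_eq_id fun β o => ?_
  apply P.hom_ext
  change (β.hom.app o).hom = 𝟙 o.fst.obj
  refine Hom.eq_id_of_comm_innerAut _ (hP o.fst.obj o.fst.property) fun g => ?_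
  obtain ⟨m, hm, -⟩ := exists_innerAut_sq p P o g
  have e := β.hom.naturality m
  simp only [CategoricalPullback.π₁_map, hm] at e
  exact congrArg InducedCategory.Hom.hom e

include hP in
/-- **`π_⋎ : 𝒳 ×_𝔈 𝒳 → 𝒳` (the projection to the second factor) is rigid on every `P`-sub-model with
slim `Π_k`**: the same argument at the second component, with `g := α⁻¹(h)` for `h ∈ Π_{A₂}`.
[cite: MochizukiAbsTopIII2015, Cor 3.7 (v) p.88] -/
theorem isRigidFunctor_proj_restrict :
    IsRigidFunctor ((modelSetting p).restrict P fun _ h => h).proj := by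
  refine isRigidFunctor_of_hom_app_eq_id fun β o => ?_
  apply P.hom_ext
  change (β.hom.app o).hom = 𝟙 o.snd.obj
  refine Hom.eq_id_of_comm_innerAut _ (hP o.snd.obj o.snd.property) fun h => ?_
  obtain ⟨m, -, hm⟩ := exists_innerAut_sq p P o ((o.iso.hom : TopGroupObj.Hom _ _).iso.symm h)
  have e := β.hom.naturality m
  simp only [CategoricalPullback.π₂_map, hm, ContinuousMulEquiv.apply_symm_apply] at e
  exact congrArg InducedCategory.Hom.hom e

include hP in
/-- **[AbsTopIII] Cor 3.7 (v), total `□`-rigidity, AT THE PRINTED INSTANCE — unconditionally.**  For the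
model of Def 3.1 on `ℚ̄_p` restricted to any object property `P` whose objects have slim `Π_k`
(print: `𝒳 = 𝒞^{MLF-sB}_{T𝔽}`, pairs of strictly Belyi type, whose `Π` is slim by [AbsTopI] Prop 2.3 (ii)),
the diagram `𝒟*` is totally `□`-rigid: `𝒳_P` is id-rigid (`isIdRigid_fullSubcategory_of_slim`, Prop 3.2
(iv)) and `pr_⋎`, `π_⋎` are rigid (`isRigidFunctor_pr_restrict`, `isRigidFunctor_proj_restrict`).
INSTANCE FORM of FACT-LIST row F-0318 (the universal closure over all abstract settings is false:
`not_forall_totallyBoxRigidStmt`). [cite: MochizukiAbsTopIII2015, Cor 3.7 (v) p.88] -/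
theorem totallyBoxRigidStmt_holds :
    Literature.AnabelianGeometry.AbsoluteAnabelian.AbsTopIII.BiAnabelianSetting.TotallyBoxRigidStmt
      ((modelSetting p).restrict P fun _ h => h) :=
  ((modelSetting p).restrict P fun _ h => h).totallyBoxRigidStmt_iff.2
    ⟨isIdRigid_fullSubcategory_of_slim P hP, isRigidFunctor_pr_restrict p P hP,
      isRigidFunctor_proj_restrict p P hP⟩

include hP in
/-- **[AbsTopIII] Cor 3.7 (v) as typed (`Cor_3_7_v`: `□` is a nexus ∧ `𝒟*` totally `□`-rigid ∧ `ℤ` acts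
by nexus-classes of self-equivalences), AT THE PRINTED INSTANCE — unconditionally**, for every
`P`-sub-model of the model with slim `Π_k`.  INSTANCE FORM of FACT-LIST row F-0314 (universal closure
false: `not_forall_cor_3_7_v`).  Improves abc-iut-L4-t9's `model_of_cor_3_7_of_full` /
`model_slim_cor_3_7_v θ` for item (v): no lift datum / Prop 3.2 (iv)-surjectivity input is needed.
[cite: MochizukiAbsTopIII2015, Cor 3.7 (v) p.88] -/
theorem cor_3_7_v_holds :
    Literature.AnabelianGeometry.AbsoluteAnabelian.AbsTopIII.BiAnabelianSetting.Cor_3_7_v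
      ((modelSetting p).restrict P fun _ h => h) :=
  ((modelSetting p).restrict P fun _ h => h).cor_3_7_v_iff_totallyBoxRigidStmt.2
    (totallyBoxRigidStmt_holds p P hP)

/-- **Cor 3.7 (v), total `□`-rigidity, for the slim sub-model `TFModel.modelSettingSlim p`**
(`P :=` slim `Π_k`), unconditionally. [cite: MochizukiAbsTopIII2015, Cor 3.7 (v) p.88] -/
theorem totallyBoxRigidStmt_modelSettingSlim :
    Literature.AnabelianGeometry.AbsoluteAnabelian.AbsTopIII.BiAnabelianSetting.TotallyBoxRigidStmt
      (modelSettingSlim p) :=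
  totallyBoxRigidStmt_holds p _ fun _ h => h

/-- **Cor 3.7 (v) as typed for the slim sub-model `TFModel.modelSettingSlim p`**, unconditionally (the
`θ` of abc-iut-L4-t9's `model_slim_cor_3_7_v θ` removed). [cite: MochizukiAbsTopIII2015, Cor 3.7 (v) p.88] -/
theorem cor_3_7_v_modelSettingSlim :
    Literature.AnabelianGeometry.AbsoluteAnabelian.AbsTopIII.BiAnabelianSetting.Cor_3_7_v
      (modelSettingSlim p) :=
  cor_3_7_v_holds p _ fun _ h => h

/-! ## The universal closures are false: the bare model (no `sB` restriction) -/

/-- **At the bare model `𝒟*` is NOT totally `□`-rigid**: total `□`-rigidity would make the vertex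
category `𝒳 = TFModel p` at `□` id-rigid, contradicting abc-iut-L4-t9's `TFModel.not_isIdRigid` (the
natural sign-twist automorphism `η ≠ id` of `𝟭_𝒳` at `(G_{ℚ_p} × ℤ/2 ↠ G_{ℚ_p} ↷ ℚ̄_p)`).  So the
"strictly Belyi type" restriction of print is load-bearing for (v).
[cite: MochizukiAbsTopIII2015, Cor 3.7 (v) p.88] -/
theorem not_totallyBoxRigidStmt_modelSetting :
    ¬ Literature.AnabelianGeometry.AbsoluteAnabelian.AbsTopIII.BiAnabelianSetting.TotallyBoxRigidStmt
      (modelSetting p) :=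
  fun h => not_isIdRigid (p := p) ((modelSetting p).isIdRigid_of_totallyBoxRigidStmt h)

/-- **At the bare model the typed Cor 3.7 (v) (`Cor_3_7_v`) FAILS** (its total-`□`-rigidity conjunct
does). [cite: MochizukiAbsTopIII2015, Cor 3.7 (v) p.88] -/
theorem not_cor_3_7_v_modelSetting :
    ¬ Literature.AnabelianGeometry.AbsoluteAnabelian.AbsTopIII.BiAnabelianSetting.Cor_3_7_v
      (modelSetting p) :=
  fun h => not_totallyBoxRigidStmt_modelSetting p
    ((modelSetting p).cor_3_7_v_iff_totallyBoxRigidStmt.1 h)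

end TFModel

namespace BiAnabelianSetting

/-- **The universal closure of FACT-LIST row F-0318 is false**: not every bi-anabelian setting has a
totally `□`-rigid `𝒟*` (witness: the bare model of Def 3.1 on `ℚ̄_2`).  R5: the row is a fact at NAMED
instances only (`TFModel.totallyBoxRigidStmt_holds`). [cite: MochizukiAbsTopIII2015, Cor 3.7 (v) p.88] -/
theorem not_forall_totallyBoxRigidStmt :
    ¬ ∀ (X E N : Type 1) (_ : Category.{1} X) (_ : Category.{1} E) (_ : Category.{1} N)
        (𝔖 : BiAnabelianSetting X E N), 𝔖.TotallyBoxRigidStmt :=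
  fun h => haveI : Fact (Nat.Prime 2) := ⟨Nat.prime_two⟩
    TFModel.not_totallyBoxRigidStmt_modelSetting 2 (h _ _ _ _ _ _ (TFModel.modelSetting 2))

/-- **The universal closure of FACT-LIST row F-0314 is false**: the typed Cor 3.7 (v) fails for some
bi-anabelian setting (the bare model on `ℚ̄_2`).  R5: NAMED instances only (`TFModel.cor_3_7_v_holds`).
[cite: MochizukiAbsTopIII2015, Cor 3.7 (v) p.88] -/
theorem not_forall_cor_3_7_v :
    ¬ ∀ (X E N : Type 1) (_ : Category.{1} X) (_ : Category.{1} E) (_ : Category.{1} N)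
        (𝔖 : BiAnabelianSetting X E N), 𝔖.Cor_3_7_v :=
  fun h => haveI : Fact (Nat.Prime 2) := ⟨Nat.prime_two⟩
    TFModel.not_cor_3_7_v_modelSetting 2 (h _ _ _ _ _ _ (TFModel.modelSetting 2))

end BiAnabelianSetting

end Literature.AnabelianGeometry.AbsoluteAnabelian.AbsTopIII
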